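import Summits.KontsevichZagierPeriods.KontsevichZagierPeriods.Theorems.HurwitzMicroSectorsNormalFormPrincipleDimOneAssembly
import Summits.KontsevichZagierPeriods.KontsevichZagierPeriods.Theorems.HyperbolicBlochOffTetraSectorKernelStubAffineOrbit
import Summits.KontsevichZagierPeriods.KontsevichZagierPeriods.Theorems.HyperbolicBlochOffTetraSectorKernelStubThreeTriangles
import Summits.KontsevichZagierPeriods.KontsevichZagierPeriods.Theorems.HyperbolicBlochOffTetraSectorKernelStubVPiece
import Summits.KontsevichZagierPeriods.KontsevichZagierPeriods.Theorems.HyperbolicBlochOffTetraSectorKernelRungZeroIntervals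
import Literature.NumberTheory.Transcendental.KZHyperbolicLadder
import Literature.NumberTheory.Transcendental.KZCubicalCalculus
import Literature.NumberTheory.Transcendental.KZDirichletPeeling
import Summits.KontsevichZagierPeriods.KontsevichZagierPeriods.Theorems.HurwitzMicroSectorsNormalFormPrincipleNfPoleOneK22

/-!
# Stub `stub_bakerEnvelope` — crux `OffTetraSectorKernel`, line `odd-hyperbolic-ladder` (skeleton v7, lead c5), auxiliary file

THE WEIGHT-ONE ENVELOPE THEOREM (Baker glues the closed sectors), auxiliary part: (i) integer combinations of MIXED NORMAL
FORMS `[pt, r] + Σ Λ(uⱼ, cⱼ) + Σ T(t_l, d_l)` (the `PiBox.Dlog` normal form of the HurwitzMicroSectors `NormalFormPrinciple`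
line) are mixed normal forms and one arctangent carrier is one; (ii) three of the five kinds of generators of the
weight-one envelope are mixed normal forms — rung-0 polytope representations (hyperbolic lengths: they ARE rational
representations of dimension one), algebraic affine images of the corner simplices `Δ_d` (c4's affine move +
`stub_cornerSimplexClass` taken as a hypothesis: `[A Δ_d + b] ≡ [pt, |det A|/d!]`) and of the unit disc (ellipses: affine
move + `stub_discClass` as a hypothesis: `[A D + b] ≡ T(1, 4|det A|)`). The hyperbolic-area generators and the registered
stub follow in `…StubBakerEnvelope.lean`.

References: A. Baker, *Transcendental Number Theory* (1975), Thm. 2.1; M. Kontsevich, D. Zagier, *Periods* (2001), §1.2.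
-/

noncomputable section

open Set MeasureTheory
open Literature.NumberTheory.Transcendental Literature.NumberTheory.Transcendental.KZ
open Literature.ModelTheory.ExponentialFields (IsSemialgebraic isSemialgebraic_univ isSemialgebraic_setOf_eval_pos
  isSemialgebraic_setOf_eval_lt)
open Summit.KontsevichZagierPeriods.HurwitzMicroSectors.NormalFormPrinciple.PiBox
open Summit.KontsevichZagierPeriods.HurwitzMicroSectors.NormalFormPrinciple.PiBox.Dlog

namespace Summit.KontsevichZagierPeriods.HyperbolicBloch.OffTetraSectorKernel

variable {RA : ℝ → ℝ → ℝ → IntegralRep 1} {ZA : ℝ → IntegralRep 0} {RG : ℝ → ℝ → IntegralRep 1}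

/-! ## Mixed normal forms: integer multiples, integer combinations, one arctangent carrier -/

/-- **Natural multiples of a mixed normal form are mixed normal forms.** [cite: KontsevichZagier2001, §1.2 rule (1)] -/
theorem env_nfD_nsmul
    (hZ : ∀ r, IsAlgebraic ℚ r → (ZA r).domain = univ ∧ (ZA r).integrand = fun _ => r)
    {x : FormalRep ⧸ relations}
    (hx : ∃ (r : ℝ) (k : ℕ) (u c : Fin k → ℝ) (k' : ℕ) (t d : Fin k' → ℝ), IsAlgebraic ℚ r ∧ (∀ j, 1 < u j) ∧
      (∀ j, IsAlgebraic ℚ (u j)) ∧ (∀ j, IsAlgebraic ℚ (c j)) ∧ (∀ l, 0 ≤ t l) ∧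
      (∀ l, IsAlgebraic ℚ (t l)) ∧ (∀ l, IsAlgebraic ℚ (d l)) ∧
      x = QuotientAddGroup.mk' relations (of (ZA r)) +
        ∑ j, QuotientAddGroup.mk' relations (of (RA 1 (u j) (c j))) +
        ∑ l, QuotientAddGroup.mk' relations (of (RG (t l) (d l)))) (n : ℕ) :
    ∃ (r : ℝ) (k : ℕ) (u c : Fin k → ℝ) (k' : ℕ) (t d : Fin k' → ℝ), IsAlgebraic ℚ r ∧ (∀ j, 1 < u j) ∧
      (∀ j, IsAlgebraic ℚ (u j)) ∧ (∀ j, IsAlgebraic ℚ (c j)) ∧ (∀ l, 0 ≤ t l) ∧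
      (∀ l, IsAlgebraic ℚ (t l)) ∧ (∀ l, IsAlgebraic ℚ (d l)) ∧
      n • x = QuotientAddGroup.mk' relations (of (ZA r)) +
        ∑ j, QuotientAddGroup.mk' relations (of (RA 1 (u j) (c j))) +
        ∑ l, QuotientAddGroup.mk' relations (of (RG (t l) (d l))) := by
  induction n with
  | zero => rw [zero_smul]; exact nfD_zero hZ
  | succ n ih => rw [succ_nsmul]; exact nfD_add hZ ih hx

/-- **Integer multiples of a mixed normal form are mixed normal forms.** [cite: KontsevichZagier2001, §1.2 rule (1)] -/
theorem env_nfD_zsmul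
    (hR : ∀ a b c, IsAlgebraic ℚ a → IsAlgebraic ℚ b → IsAlgebraic ℚ c → 0 < a →
      (RA a b c).domain = {x | x 0 ∈ Set.Ioo a b} ∧ (RA a b c).integrand = fun x => c / x 0)
    (hZ : ∀ r, IsAlgebraic ℚ r → (ZA r).domain = univ ∧ (ZA r).integrand = fun _ => r)
    (hRG : ∀ t d, IsAlgebraic ℚ t → IsAlgebraic ℚ d →
      (RG t d).domain = {x | x 0 ∈ Set.Ioo 0 t} ∧ (RG t d).integrand = fun x => d / (1 + x 0 ^ 2))
    {x : FormalRep ⧸ relations}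
    (hx : ∃ (r : ℝ) (k : ℕ) (u c : Fin k → ℝ) (k' : ℕ) (t d : Fin k' → ℝ), IsAlgebraic ℚ r ∧ (∀ j, 1 < u j) ∧
      (∀ j, IsAlgebraic ℚ (u j)) ∧ (∀ j, IsAlgebraic ℚ (c j)) ∧ (∀ l, 0 ≤ t l) ∧
      (∀ l, IsAlgebraic ℚ (t l)) ∧ (∀ l, IsAlgebraic ℚ (d l)) ∧
      x = QuotientAddGroup.mk' relations (of (ZA r)) +
        ∑ j, QuotientAddGroup.mk' relations (of (RA 1 (u j) (c j))) +
        ∑ l, QuotientAddGroup.mk' relations (of (RG (t l) (d l)))) (n : ℤ) :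
    ∃ (r : ℝ) (k : ℕ) (u c : Fin k → ℝ) (k' : ℕ) (t d : Fin k' → ℝ), IsAlgebraic ℚ r ∧ (∀ j, 1 < u j) ∧
      (∀ j, IsAlgebraic ℚ (u j)) ∧ (∀ j, IsAlgebraic ℚ (c j)) ∧ (∀ l, 0 ≤ t l) ∧
      (∀ l, IsAlgebraic ℚ (t l)) ∧ (∀ l, IsAlgebraic ℚ (d l)) ∧
      n • x = QuotientAddGroup.mk' relations (of (ZA r)) +
        ∑ j, QuotientAddGroup.mk' relations (of (RA 1 (u j) (c j))) +
        ∑ l, QuotientAddGroup.mk' relations (of (RG (t l) (d l))) := by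
  cases n with
  | ofNat m => rw [Int.ofNat_eq_natCast, natCast_zsmul]; exact env_nfD_nsmul hZ hx m
  | negSucc m =>
    rw [negSucc_zsmul]
    exact nfD_neg hR hZ hRG (env_nfD_nsmul hZ hx (m + 1))

/-- **Integer combinations of mixed normal forms are mixed normal forms.** [cite: KontsevichZagier2001, §1.2 rule (1)] -/
theorem env_nfD_sum_zsmul
    (hR : ∀ a b c, IsAlgebraic ℚ a → IsAlgebraic ℚ b → IsAlgebraic ℚ c → 0 < a →
      (RA a b c).domain = {x | x 0 ∈ Set.Ioo a b} ∧ (RA a b c).integrand = fun x => c / x 0)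
    (hZ : ∀ r, IsAlgebraic ℚ r → (ZA r).domain = univ ∧ (ZA r).integrand = fun _ => r)
    (hRG : ∀ t d, IsAlgebraic ℚ t → IsAlgebraic ℚ d →
      (RG t d).domain = {x | x 0 ∈ Set.Ioo 0 t} ∧ (RG t d).integrand = fun x => d / (1 + x 0 ^ 2))
    {ι : Type*} (s : Finset ι) (e : ι → ℤ) (f : ι → FormalRep ⧸ relations)
    (h : ∀ i ∈ s, ∃ (r : ℝ) (k : ℕ) (u c : Fin k → ℝ) (k' : ℕ) (t d : Fin k' → ℝ), IsAlgebraic ℚ r ∧ (∀ j, 1 < u j) ∧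
        (∀ j, IsAlgebraic ℚ (u j)) ∧ (∀ j, IsAlgebraic ℚ (c j)) ∧ (∀ l, 0 ≤ t l) ∧
        (∀ l, IsAlgebraic ℚ (t l)) ∧ (∀ l, IsAlgebraic ℚ (d l)) ∧
        f i = QuotientAddGroup.mk' relations (of (ZA r)) +
          ∑ j, QuotientAddGroup.mk' relations (of (RA 1 (u j) (c j))) +
          ∑ l, QuotientAddGroup.mk' relations (of (RG (t l) (d l)))) :
    ∃ (r : ℝ) (k : ℕ) (u c : Fin k → ℝ) (k' : ℕ) (t d : Fin k' → ℝ), IsAlgebraic ℚ r ∧ (∀ j, 1 < u j) ∧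
      (∀ j, IsAlgebraic ℚ (u j)) ∧ (∀ j, IsAlgebraic ℚ (c j)) ∧ (∀ l, 0 ≤ t l) ∧
      (∀ l, IsAlgebraic ℚ (t l)) ∧ (∀ l, IsAlgebraic ℚ (d l)) ∧
      ∑ i ∈ s, e i • f i = QuotientAddGroup.mk' relations (of (ZA r)) +
        ∑ j, QuotientAddGroup.mk' relations (of (RA 1 (u j) (c j))) +
        ∑ l, QuotientAddGroup.mk' relations (of (RG (t l) (d l))) :=
  nfD_sum hZ s (fun i => e i • f i) fun i hi => env_nfD_zsmul hR hZ hRG (h i hi) (e i)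

/-- **One arctangent carrier `T(t, d)` (`t ≥ 0`) is a mixed normal form.** [cite: KontsevichZagier2001, §1.2] -/
theorem env_nfD_carrierG
    (hZ : ∀ r, IsAlgebraic ℚ r → (ZA r).domain = univ ∧ (ZA r).integrand = fun _ => r)
    {t₀ d₀ : ℝ} (ht : IsAlgebraic ℚ t₀) (hd : IsAlgebraic ℚ d₀) (ht0 : 0 ≤ t₀) :
    ∃ (r : ℝ) (k : ℕ) (u c : Fin k → ℝ) (k' : ℕ) (t d : Fin k' → ℝ), IsAlgebraic ℚ r ∧ (∀ j, 1 < u j) ∧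
      (∀ j, IsAlgebraic ℚ (u j)) ∧ (∀ j, IsAlgebraic ℚ (c j)) ∧ (∀ l, 0 ≤ t l) ∧
      (∀ l, IsAlgebraic ℚ (t l)) ∧ (∀ l, IsAlgebraic ℚ (d l)) ∧
      QuotientAddGroup.mk' relations (of (RG t₀ d₀)) = QuotientAddGroup.mk' relations (of (ZA r)) +
        ∑ j, QuotientAddGroup.mk' relations (of (RA 1 (u j) (c j))) +
        ∑ l, QuotientAddGroup.mk' relations (of (RG (t l) (d l))) := by
  have hZ0 : QuotientAddGroup.mk' relations (of (ZA 0)) = 0 :=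
    (QuotientAddGroup.eq_zero_iff _).mpr (pt_zero_mem_relations (ZA 0) (hZ 0 isAlgebraic_zero).2)
  refine ⟨0, 0, Fin.elim0, Fin.elim0, 1, ![t₀], ![d₀], isAlgebraic_zero, fun j => j.elim0, fun j => j.elim0,
    fun j => j.elim0, fun l => ?_, fun l => ?_, fun l => ?_, ?_⟩
  · fin_cases l; simpa using ht0
  · fin_cases l; simpa using ht
  · fin_cases l; simpa using hd
  · rw [Finset.univ_eq_empty (α := Fin 0), Finset.sum_empty, add_zero, hZ0, zero_add, Fin.sum_univ_one]
    rfl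

/-! ## Three kinds of generators are mixed normal forms: lengths, simplices, ellipses -/

/-- **Rung-0 polytope representations are rational representations of dimension one**, hence mixed normal forms
(`PiBox.Dlog.nfD_of_isRational_dim_le_one`). [cite: KontsevichZagier2001, §1.1] -/
theorem env_nfD_rungZero
    (hR : ∀ a b c, IsAlgebraic ℚ a → IsAlgebraic ℚ b → IsAlgebraic ℚ c → 0 < a →
      (RA a b c).domain = {x | x 0 ∈ Set.Ioo a b} ∧ (RA a b c).integrand = fun x => c / x 0)
    (hZ : ∀ r, IsAlgebraic ℚ r → (ZA r).domain = univ ∧ (ZA r).integrand = fun _ => r)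
    (hRG : ∀ t d, IsAlgebraic ℚ t → IsAlgebraic ℚ d →
      (RG t d).domain = {x | x 0 ∈ Set.Ioo 0 t} ∧ (RG t d).integrand = fun x => d / (1 + x 0 ^ 2))
    (N : IntegralRep 1) (hP : IsGeodesicPolytope 0 N.domain) (hri : EqOn N.integrand (hypDensity 0) N.domain) :
    ∃ (r : ℝ) (k : ℕ) (u c : Fin k → ℝ) (k' : ℕ) (t d : Fin k' → ℝ), IsAlgebraic ℚ r ∧ (∀ j, 1 < u j) ∧
      (∀ j, IsAlgebraic ℚ (u j)) ∧ (∀ j, IsAlgebraic ℚ (c j)) ∧ (∀ l, 0 ≤ t l) ∧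
      (∀ l, IsAlgebraic ℚ (t l)) ∧ (∀ l, IsAlgebraic ℚ (d l)) ∧
      QuotientAddGroup.mk' relations (of N) = QuotientAddGroup.mk' relations (of (ZA r)) +
        ∑ j, QuotientAddGroup.mk' relations (of (RA 1 (u j) (c j))) +
        ∑ l, QuotientAddGroup.mk' relations (of (RG (t l) (d l))) := by
  have hrat : N.IsRational := by
    obtain ⟨k, flat, a, c, ε, -, -, -, -, hPeq, -⟩ := hP
    refine ⟨MvPolynomial.C 1, MvPolynomial.X 0, fun x hx => ?_, fun x hx => ?_⟩
    · rw [hPeq] at hx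
      rw [MvPolynomial.aeval_X]
      exact ne_of_gt hx.1
    · rw [hri hx]
      simp [hypDensity, Fin.last, MvPolynomial.aeval_X]
  exact nfD_of_isRational_dim_le_one hR hZ hRG le_rfl N hrat

/-- The corner simplex lies in the unit cube, so it has volume `≤ 1`. [folklore] -/
theorem env_volume_cornerSimplex_ne_top (d : ℕ) :
    volume {x : Fin d → ℝ | (∀ i, 0 < x i) ∧ ∑ i, x i < 1} ≠ ⊤ := by
  refine ((measure_mono ?_).trans_lt (by rw [volume_cube]; exact ENNReal.one_lt_top)).ne
  intro x hx
  rw [mem_cube]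
  intro i
  refine ⟨(hx.1 i).le, ?_⟩
  have : x i ≤ ∑ j, x j := Finset.single_le_sum (fun j _ => (hx.1 j).le) (Finset.mem_univ i)
  linarith [hx.2]

/-- **Algebraic affine images of corner simplices are points** `[pt, |det A|/d!]`, hence mixed normal forms
(c4's affine move `aff_orbit_of_sub_of_mem_changeOfVariablesRel` + `stub_cornerSimplexClass`).
[cite: KontsevichZagier2001, §1.2 rules (2), (3)] -/
theorem env_nfD_simplexImage
    (hZ : ∀ r, IsAlgebraic ℚ r → (ZA r).domain = univ ∧ (ZA r).integrand = fun _ => r)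
    (hSimp : ∀ (d : ℕ) (c : ℝ), IsAlgebraic ℚ c →
      ∀ (S : IntegralRep d), S.domain = {x | (∀ i, 0 < x i) ∧ ∑ i, x i < 1} →
        (∀ x ∈ S.domain, S.integrand x = c) →
      ∀ (Z : IntegralRep 0), Z.domain = univ → (Z.integrand = fun _ => c / (Nat.factorial d : ℝ)) →
        of S - of Z ∈ relations)
    {d : ℕ} {A : Matrix (Fin d) (Fin d) ℝ} {b : Fin d → ℝ} (hA : ∀ j l, IsAlgebraic ℚ (A j l))
    (hb : ∀ j, IsAlgebraic ℚ (b j)) (hdet : A.det ≠ 0) (N : IntegralRep d)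
    (hdom : N.domain = (fun x => A.mulVec x + b) '' {x | (∀ i, 0 < x i) ∧ ∑ i, x i < 1})
    (hone : ∀ x ∈ N.domain, N.integrand x = 1) :
    ∃ (r : ℝ) (k : ℕ) (u c : Fin k → ℝ) (k' : ℕ) (t d : Fin k' → ℝ), IsAlgebraic ℚ r ∧ (∀ j, 1 < u j) ∧
      (∀ j, IsAlgebraic ℚ (u j)) ∧ (∀ j, IsAlgebraic ℚ (c j)) ∧ (∀ l, 0 ≤ t l) ∧
      (∀ l, IsAlgebraic ℚ (t l)) ∧ (∀ l, IsAlgebraic ℚ (d l)) ∧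
      QuotientAddGroup.mk' relations (of N) = QuotientAddGroup.mk' relations (of (ZA r)) +
        ∑ j, QuotientAddGroup.mk' relations (of (RA 1 (u j) (c j))) +
        ∑ l, QuotientAddGroup.mk' relations (of (RG (t l) (d l))) := by
  obtain ⟨S1, hS1d, hS1i⟩ := exists_oneRep (isSemialgebraic_dirichletSimplex d) (env_volume_cornerSimplex_ne_top d)
  have hcA : IsAlgebraic ℚ |A.det| := aff_orbit_isAlgebraic_abs_det hA
  set S := S1.constMul |A.det| hcA with hSdef
  have hSd : S.domain = {x | (∀ i, 0 < x i) ∧ ∑ i, x i < 1} := by rw [hSdef, IntegralRep.domain_constMul, hS1d]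
  have hSi : ∀ x ∈ S.domain, S.integrand x = |A.det| := fun x _ => by
    simp [hSdef, IntegralRep.constMul, hS1i]
  have e1 : of S - of N ∈ relations := by
    refine changeOfVariablesRel_subset_relations
      (aff_orbit_of_sub_of_mem_changeOfVariablesRel A b hA hb hdet S N (by rw [hdom, hSd]) fun x hx => ?_)
    rw [hSi x hx, hone _ (by rw [hdom, ← hSd]; exact mem_image_of_mem _ hx), one_mul]
  have hq : IsAlgebraic ℚ (|A.det| / (Nat.factorial d : ℝ)) := by
    rw [div_eq_mul_inv]
    exact hcA.mul (isAlgebraic_nat _).inv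
  obtain ⟨hZd, hZi⟩ := hZ _ hq
  have e2 : of S - of (ZA (|A.det| / (Nat.factorial d : ℝ))) ∈ relations := hSimp d _ hcA S hSd hSi _ hZd hZi
  have e : of N - of (ZA (|A.det| / (Nat.factorial d : ℝ))) ∈ relations := by
    have := relations.sub_mem e2 e1
    rwa [sub_sub_sub_cancel_left] at this
  rw [K22.mk_eq_mk_of_sub_mem e]
  exact nfD_pt hZ hq _ hZd hZi

/-- The open unit disc is `ℚ`-semialgebraic. [folklore] -/
theorem env_isSemialgebraic_disc : IsSemialgebraic ℚ {p : Fin 2 → ℝ | p 0 ^ 2 + p 1 ^ 2 < 1} := by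
  have hset : {p : Fin 2 → ℝ | p 0 ^ 2 + p 1 ^ 2 < 1} =
      {x | MvPolynomial.aeval x (MvPolynomial.X 0 ^ 2 + MvPolynomial.X 1 ^ 2 : MvPolynomial (Fin 2) ℚ) <
        MvPolynomial.aeval x (MvPolynomial.C 1 : MvPolynomial (Fin 2) ℚ)} := by
    ext p
    simp [MvPolynomial.aeval_X]
  rw [hset]
  exact isSemialgebraic_setOf_eval_lt _ _

/-- The open unit disc has finite area (it lies in the square `[−1, 1]²`). [folklore] -/
theorem env_volume_disc_ne_top : volume {p : Fin 2 → ℝ | p 0 ^ 2 + p 1 ^ 2 < 1} ≠ ⊤ := by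
  refine (Bornology.IsBounded.measure_lt_top ?_).ne
  refine (Metric.isBounded_closedBall (x := (0 : Fin 2 → ℝ)) (r := 1)).subset fun p hp => ?_
  rw [Metric.mem_closedBall, dist_zero_right, pi_norm_le_iff_of_nonneg zero_le_one]
  have hp' : p 0 ^ 2 + p 1 ^ 2 < 1 := hp
  intro i
  rw [Real.norm_eq_abs]
  have hi : p i ^ 2 ≤ ∑ j, p j ^ 2 := Finset.single_le_sum (fun j _ => sq_nonneg (p j)) (Finset.mem_univ i)
  rw [Fin.sum_univ_two] at hi
  exact ((sq_lt_one_iff_abs_lt_one (p i)).mp (lt_of_le_of_lt hi hp')).le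

/-- **Algebraic affine images of the unit disc (ellipses) are arctangent carriers** `T(1, 4|det A|)`, hence mixed
normal forms (c4's affine move + `stub_discClass`). [cite: KontsevichZagier2001, §1.1] -/
theorem env_nfD_discImage
    (hZ : ∀ r, IsAlgebraic ℚ r → (ZA r).domain = univ ∧ (ZA r).integrand = fun _ => r)
    (hRG : ∀ t d, IsAlgebraic ℚ t → IsAlgebraic ℚ d →
      (RG t d).domain = {x | x 0 ∈ Set.Ioo 0 t} ∧ (RG t d).integrand = fun x => d / (1 + x 0 ^ 2))
    (hDisc : ∀ (c : ℝ), IsAlgebraic ℚ c →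
      ∀ (D : IntegralRep 2), D.domain = {p | p 0 ^ 2 + p 1 ^ 2 < 1} → (∀ p ∈ D.domain, D.integrand p = c) →
      ∀ (L : IntegralRep 1), L.domain = {x | x 0 ∈ Ioo 0 1} →
        (L.integrand = fun x => 4 * c / (1 + x 0 ^ 2)) → of D - of L ∈ relations)
    {A : Matrix (Fin 2) (Fin 2) ℝ} {b : Fin 2 → ℝ} (hA : ∀ j l, IsAlgebraic ℚ (A j l))
    (hb : ∀ j, IsAlgebraic ℚ (b j)) (hdet : A.det ≠ 0) (N : IntegralRep 2)
    (hdom : N.domain = (fun x => A.mulVec x + b) '' {p | p 0 ^ 2 + p 1 ^ 2 < 1})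
    (hone : ∀ x ∈ N.domain, N.integrand x = 1) :
    ∃ (r : ℝ) (k : ℕ) (u c : Fin k → ℝ) (k' : ℕ) (t d : Fin k' → ℝ), IsAlgebraic ℚ r ∧ (∀ j, 1 < u j) ∧
      (∀ j, IsAlgebraic ℚ (u j)) ∧ (∀ j, IsAlgebraic ℚ (c j)) ∧ (∀ l, 0 ≤ t l) ∧
      (∀ l, IsAlgebraic ℚ (t l)) ∧ (∀ l, IsAlgebraic ℚ (d l)) ∧
      QuotientAddGroup.mk' relations (of N) = QuotientAddGroup.mk' relations (of (ZA r)) +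
        ∑ j, QuotientAddGroup.mk' relations (of (RA 1 (u j) (c j))) +
        ∑ l, QuotientAddGroup.mk' relations (of (RG (t l) (d l))) := by
  obtain ⟨S1, hS1d, hS1i⟩ := exists_oneRep env_isSemialgebraic_disc env_volume_disc_ne_top
  have hcA : IsAlgebraic ℚ |A.det| := aff_orbit_isAlgebraic_abs_det hA
  set S := S1.constMul |A.det| hcA with hSdef
  have hSd : S.domain = {p | p 0 ^ 2 + p 1 ^ 2 < 1} := by rw [hSdef, IntegralRep.domain_constMul, hS1d]
  have hSi : ∀ x ∈ S.domain, S.integrand x = |A.det| := fun x _ => by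
    simp [hSdef, IntegralRep.constMul, hS1i]
  have e1 : of S - of N ∈ relations := by
    refine changeOfVariablesRel_subset_relations
      (aff_orbit_of_sub_of_mem_changeOfVariablesRel A b hA hb hdet S N (by rw [hdom, hSd]) fun x hx => ?_)
    rw [hSi x hx, hone _ (by rw [hdom, ← hSd]; exact mem_image_of_mem _ hx), one_mul]
  have h4 : IsAlgebraic ℚ (4 * |A.det|) := (isAlgebraic_nat 4).mul hcA
  obtain ⟨hLd, hLi⟩ := hRG 1 (4 * |A.det|) isAlgebraic_one h4
  have e2 : of S - of (RG 1 (4 * |A.det|)) ∈ relations := hDisc _ hcA S hSd hSi _ hLd hLi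
  have e : of N - of (RG 1 (4 * |A.det|)) ∈ relations := by
    have := relations.sub_mem e2 e1
    rwa [sub_sub_sub_cancel_left] at this
  rw [K22.mk_eq_mk_of_sub_mem e]
  exact env_nfD_carrierG hZ isAlgebraic_one h4 zero_le_one


/-- **Registered sub-goal `env_rungZeroClass` (closed form of `env_nfD_rungZero`)**: for every choice of carriers, the
class of a rung-0 polytope representation (a hyperbolic length) is a mixed normal form. [cite: KontsevichZagier2001, §1.2] -/
theorem env_rungZeroClass : ∀ (RA : ℝ → ℝ → ℝ → Literature.NumberTheory.Transcendental.KZ.IntegralRep 1) (ZA : ℝ → Literature.NumberTheory.Transcendental.KZ.IntegralRep 0) (RG : ℝ → ℝ → Literature.NumberTheory.Transcendental.KZ.IntegralRep 1), (∀ a b c, IsAlgebraic ℚ a → IsAlgebraic ℚ b → IsAlgebraic ℚ c → 0 < a → (RA a b c).domain = {x | x 0 ∈ Set.Ioo a b} ∧ (RA a b c).integrand = fun x => c / x 0) → (∀ r, IsAlgebraic ℚ r → (ZA r).domain = Set.univ ∧ (ZA r).integrand = fun _ => r) → (∀ t d, IsAlgebraic ℚ t → IsAlgebraic ℚ d → (RG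 t d).domain = {x | x 0 ∈ Set.Ioo 0 t} ∧ (RG t d).integrand = fun x => d / (1 + x 0 ^ 2)) → ∀ (N : Literature.NumberTheory.Transcendental.KZ.IntegralRep 1), Literature.NumberTheory.Transcendental.KZ.IsGeodesicPolytope 0 N.domain → Set.EqOn N.integrand (Literature.NumberTheory.Transcendental.KZ.hypDensity 0) N.domain → ∃ (r : ℝ) (k : ℕ) (u c : Fin k → ℝ) (k' : ℕ) (t d : Fin k' → ℝ), IsAlgebraic ℚ r ∧ (∀ j, 1 < u j) ∧ (∀ j, IsAlgebraic ℚ (u j)) ∧ (∀ j, IsAlgebraic ℚ (c j)) ∧ (∀ l, 0 ≤ t l) ∧ (∀ l, IsAlgebraic ℚ (t l)) ∧ (∀ l, IsAlgebraic ℚ (d l)) ∧ QuotientAddGroup.mk' Literature.NumberTheory.Transcendental.KZ.relations (Literature.NumberTheory.Transcendental.KZ.of N) = QuotientAddGroup.mk' Literature.NumberTheory.Transcendental.KZ.relations (Literature.NumberTheory.Transcendental.KZ.of (ZA r)) + ∑ j, QuotientAddGroup.mk' Literature.NumberTheory.Transcendental.KZ.relations (Literature.NumberTheory.Transcendental.KZ.of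 (RA 1 (u j) (c j))) + ∑ l, QuotientAddGroup.mk' Literature.NumberTheory.Transcendental.KZ.relations (Literature.NumberTheory.Transcendental.KZ.of (RG (t l) (d l))) :=
  fun _ _ _ hR hZ hRG N hP hri => env_nfD_rungZero hR hZ hRG N hP hri

end Summit.KontsevichZagierPeriods.HyperbolicBloch.OffTetraSectorKernel

end
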